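import Mathlib.MeasureTheory.Constructions.Pi
import Mathlib.MeasureTheory.Integral.Lebesgue.Map
import Mathlib.MeasureTheory.Integral.Marginal

/-!
# Uncurrying and relabelling finite product measures

Helper for stub `stub_spreadFromPartsR3` (S6′, reshape r3) of line `free-volume-heavy-witness`
(crux `Summit.QuantumFields.QCD.Theses.SpectralDefectExtinction.WindowExtinction`,
item stmt-QuantumFields-8964).  Pure measure theory, no project vocabulary.

The links of a family of disjoint cores of the torus are labelled by `core × (box site × direction)`;
reading the contents core by core is an uncurrying followed by a relabelling.  This file records that
both operations transport the product Haar measure: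

* `spreadR3_measurePreserving_uncurry` — `(I → K → α, (ν^{⊗K})^{⊗I}) → (I × K → α, ν^{⊗(I×K)})`,
  `t ↦ ((i,k) ↦ t i k)`, preserves the product measures (`σ`-finite `ν`);
* `spreadR3_lintegral_relabel` — for a bijective labelling `σ : I × K ≃ ↥E` of a finite set `E` of
  coordinates, `∫ f dν^{⊗E} = ∫ f (e ↦ t (σ⁻¹ e).1 (σ⁻¹ e).2) d(ν^{⊗K})^{⊗I}(t)`;
* `spreadR3_lmarginal_relabel` — the same for the fibre integral `lmarginal … E` of a function on the
  full product: integrating out the coordinates of `E` with the others frozen at `x` is the integral of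
  `f (updateFinset x E (e ↦ t (σ⁻¹ e).1 (σ⁻¹ e).2))` against `(ν^{⊗K})^{⊗I}`.
-/

noncomputable section

namespace Summit.QuantumFields.QCD.Cruxes.WindowExtinction.FreeVolumeHeavyWitness

open MeasureTheory Set Function
open scoped ENNReal BigOperators

variable {I K α : Type*} [Fintype I] [Fintype K] [MeasurableSpace α]

/-- **Uncurrying preserves product measures.** For a `σ`-finite measure `ν` on `α`, the map
`t ↦ ((i, k) ↦ t i k)` pushes `(ν^{⊗K})^{⊗I}` to `ν^{⊗(I × K)}`. -/
theorem spreadR3_measurePreserving_uncurry (ν : Measure α) [SigmaFinite ν] :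
    MeasurePreserving (fun t : I → K → α => fun p : I × K => t p.1 p.2)
      (Measure.pi fun _ : I => Measure.pi fun _ : K => ν) (Measure.pi fun _ : I × K => ν) := by
  have hmeas : Measurable fun t : I → K → α => fun p : I × K => t p.1 p.2 :=
    measurable_pi_lambda _ fun p => (measurable_pi_apply p.2).comp (measurable_pi_apply p.1)
  refine ⟨hmeas, ?_⟩
  symm
  refine Measure.pi_eq fun s hs => ?_
  rw [Measure.map_apply hmeas (MeasurableSet.univ_pi hs)]
  have hpre : (fun t : I → K → α => fun p : I × K => t p.1 p.2) ⁻¹' Set.univ.pi s =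
      Set.univ.pi fun i => Set.univ.pi fun k => s (i, k) := by
    ext t; simp
  rw [hpre, Measure.pi_pi]
  simp_rw [Measure.pi_pi]
  rw [← Finset.univ_product_univ, Finset.prod_product]

/-- **The uncurry-and-relabel map transports `(ν^{⊗K})^{⊗I}` to `ν^{⊗E}`.**  For a bijective
labelling `σ : I × K ≃ ↥E` of a finite set `E` of coordinates, the measurable equivalence
`(curry I K α)⁻¹ ≫ piCongrLeft σ : (I → K → α) ≃ᵐ (↥E → α)` — pointwise `t ↦ (e ↦ t (σ⁻¹ e).1 (σ⁻¹ e).2)`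
— is measure preserving. -/
theorem spreadR3_measurePreserving_relabel {ι : Type*} (ν : Measure α) [SigmaFinite ν]
    (E : Finset ι) (σ : I × K ≃ ↥E) :
    MeasurePreserving
      ((MeasurableEquiv.curry I K α).symm.trans (MeasurableEquiv.piCongrLeft (fun _ : ↥E => α) σ))
      (Measure.pi fun _ : I => Measure.pi fun _ : K => ν) (Measure.pi fun _ : ↥E => ν) := by
  have h1 : MeasurePreserving (MeasurableEquiv.curry I K α).symm
      (Measure.pi fun _ : I => Measure.pi fun _ : K => ν) (Measure.pi fun _ : I × K => ν) :=
    spreadR3_measurePreserving_uncurry ν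
  have h2 := measurePreserving_piCongrLeft (fun _ : ↥E => ν) σ
  exact h2.comp h1

omit [Fintype I] [Fintype K] in
/-- Pointwise form of the uncurry-and-relabel equivalence. -/
theorem spreadR3_relabel_apply {ι : Type*} (E : Finset ι) (σ : I × K ≃ ↥E) (t : I → K → α)
    (e : ↥E) :
    ((MeasurableEquiv.curry I K α).symm.trans (MeasurableEquiv.piCongrLeft (fun _ : ↥E => α) σ))
        t e = t (σ.symm e).1 (σ.symm e).2 := by
  simp only [MeasurableEquiv.trans_apply, MeasurableEquiv.coe_piCongrLeft,
    MeasurableEquiv.coe_curry_symm, Equiv.piCongrLeft_apply_eq_cast, cast_eq, Function.uncurry]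

/-- **Relabelling a product integral.** For a bijective labelling `σ : I × K ≃ ↥E`,
`∫ f dν^{⊗E} = ∫ f (e ↦ t (σ⁻¹ e).1 (σ⁻¹ e).2) d(ν^{⊗K})^{⊗I}(t)`. -/
theorem spreadR3_lintegral_relabel {ι : Type*} (ν : Measure α) [SigmaFinite ν]
    (E : Finset ι) (σ : I × K ≃ ↥E) (f : (↥E → α) → ℝ≥0∞) :
    ∫⁻ y, f y ∂(Measure.pi fun _ : ↥E => ν) =
      ∫⁻ t : I → K → α, f (fun e => t (σ.symm e).1 (σ.symm e).2)
        ∂(Measure.pi fun _ : I => Measure.pi fun _ : K => ν) := by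
  have h := (spreadR3_measurePreserving_relabel ν E σ).lintegral_comp_emb
    ((MeasurableEquiv.curry I K α).symm.trans
      (MeasurableEquiv.piCongrLeft (fun _ : ↥E => α) σ)).measurableEmbedding f
  rw [← h]
  refine lintegral_congr fun t => ?_
  congr 1
  funext e
  exact spreadR3_relabel_apply E σ t e

/-- **Relabelling a fibre integral.** Integrating out the coordinates of `E` (the others frozen at `x`)
is the integral over the relabelled contents:
`lmarginal ν E f x = ∫ f (updateFinset x E (e ↦ t (σ⁻¹ e).1 (σ⁻¹ e).2)) d(ν^{⊗K})^{⊗I}(t)`. -/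
theorem spreadR3_lmarginal_relabel :
    ∀ {I K α ι : Type*} [Fintype I] [Fintype K] [MeasurableSpace α] [DecidableEq ι]
      (ν : Measure α) [SigmaFinite ν] (E : Finset ι) (σ : I × K ≃ ↥E) (f : (ι → α) → ℝ≥0∞)
      (x : ι → α),
      lmarginal (fun _ : ι => ν) E f x =
        ∫⁻ t : I → K → α, f (updateFinset x E fun e => t (σ.symm e).1 (σ.symm e).2)
          ∂(Measure.pi fun _ : I => Measure.pi fun _ : K => ν) := by
  intro I K α ι _ _ _ _ ν _ E σ f x
  simp only [lmarginal]
  exact spreadR3_lintegral_relabel ν E σ _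

end Summit.QuantumFields.QCD.Cruxes.WindowExtinction.FreeVolumeHeavyWitness

end
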